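import Mathlib
import Summits.ValiantsHypothesis.ValiantsHypothesis.Theorems.NewtonUnitEquationsTwoProductsPowerSumCriterion
import Summits.ValiantsHypothesis.ValiantsHypothesis.Theorems.NewtonUnitEquationsTwoProductsDissocLift

/-! # Stub `stub_dissocBridge` — crux `TwoProducts` (stmt-ValiantsHypothesis-5906), line `corner-log-linearization`

Rung piece R3 (lead c3), part 2 of 2: the BRIDGE from the polynomial picture to the moment picture in the dissociated regime.

With the letters `U` (nonzero support points of the `2n` factors), the lifted log power sum
`Λ̃_R = Σ_{r=1}^R κ_r (Σ_i ũ_i^r − Σ_i ṽ_i^r)` (`ũ_i = Σ_{a∈U} (coeff_a u_i) z_a` the lifted tails) projects under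
`π : z_a ↦ x^a` to the log power sum `Λ_R` of the power-sum criterion (landed), and `coeff_m Λ̃_R = K_R(m) · μ̂(m)` with the
moment `μ̂(m) = Σ_i ∏_a (coeff_a u_i)^{m_a} − Σ_i ∏_a (coeff_a v_i)^{m_a}` and the universal constant `K_R(m) ≠ 0` for
`1 ≤ |m| ≤ R` (part 1, `…DissocLift`).  Since `coeff_p Λ_R = Σ_{φ(m)=p} coeff_m Λ̃_R`, injectivity of `φ` on the multisets of
weight `≤ wt e` makes every such fibre a singleton: a unique `w`-lightest support point `e` of `∏u − ∏v` (criterion at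
`R = wt e + 1`) is `φ(m*)` with `μ̂(m*) ≠ 0`, and every other multiset of weight `≤ wt e` has `μ̂ = 0`. [folklore] -/

set_option linter.dupNamespace false -- single-conjunct summit: `ValiantsHypothesis.ValiantsHypothesis`

namespace Summit.ValiantsHypothesis.ValiantsHypothesis.Theorems.TwoProducts.DissocBridge

open scoped BigOperators
open MvPolynomial

variable {n : ℕ}

/-- The projection of the lifted log power sum is the log power sum of the power-sum criterion. [folklore] -/
theorem proj_liftLog (u v : Fin n → MvPolynomial (Fin 2) ℂ) (hu : ∀ i, coeff 0 (u i) = 1)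
    (hv : ∀ i, coeff 0 (v i) = 1) (U : Finset (Fin 2 →₀ ℕ)) (h0 : (0 : Fin 2 →₀ ℕ) ∉ U)
    (hU : ∀ i, ∀ a ∈ (u i).support, a ≠ 0 → a ∈ U) (hV : ∀ i, ∀ a ∈ (v i).support, a ≠ 0 → a ∈ U) (R : ℕ) :
    aeval (fun a : Fin 2 →₀ ℕ => (monomial a (1 : ℂ) : MvPolynomial (Fin 2) ℂ))
      (∑ r ∈ Finset.Icc 1 R, ((-1 : ℂ) ^ (r + 1) / (r : ℂ)) •
        (∑ i, (∑ a ∈ U, C (coeff a (u i)) * X a : MvPolynomial (Fin 2 →₀ ℕ) ℂ) ^ r -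
          ∑ i, (∑ a ∈ U, C (coeff a (v i)) * X a : MvPolynomial (Fin 2 →₀ ℕ) ℂ) ^ r)) =
      ∑ r ∈ Finset.Icc 1 R, ((-1 : ℂ) ^ (r + 1) / (r : ℂ)) • (∑ i, (u i - 1) ^ r - ∑ i, (v i - 1) ^ r) := by
  have hU' : ∀ i, aeval (fun a : Fin 2 →₀ ℕ => (monomial a (1 : ℂ) : MvPolynomial (Fin 2) ℂ))
      (∑ a ∈ U, C (coeff a (u i)) * X a : MvPolynomial (Fin 2 →₀ ℕ) ℂ) = u i - 1 := fun i =>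
    DissocLift.proj_liftTail U (u i) (hu i) h0 (hU i)
  have hV' : ∀ i, aeval (fun a : Fin 2 →₀ ℕ => (monomial a (1 : ℂ) : MvPolynomial (Fin 2) ℂ))
      (∑ a ∈ U, C (coeff a (v i)) * X a : MvPolynomial (Fin 2 →₀ ℕ) ℂ) = v i - 1 := fun i =>
    DissocLift.proj_liftTail U (v i) (hv i) h0 (hV i)
  simp only [map_sum, map_smul, map_sub, map_pow, hU', hV']

/-- Coefficient formula for the lifted log power sum: `coeff_m Λ̃_R = K_R(m) · μ̂(m)`. [folklore] -/
theorem coeff_liftLog (u v : Fin n → MvPolynomial (Fin 2) ℂ) (U : Finset (Fin 2 →₀ ℕ)) (R : ℕ)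
    (m : (Fin 2 →₀ ℕ) →₀ ℕ) :
    coeff m (∑ r ∈ Finset.Icc 1 R, ((-1 : ℂ) ^ (r + 1) / (r : ℂ)) •
        (∑ i, (∑ a ∈ U, C (coeff a (u i)) * X a : MvPolynomial (Fin 2 →₀ ℕ) ℂ) ^ r -
          ∑ i, (∑ a ∈ U, C (coeff a (v i)) * X a : MvPolynomial (Fin 2 →₀ ℕ) ℂ) ^ r)) =
      (∑ r ∈ Finset.Icc 1 R, ((-1 : ℂ) ^ (r + 1) / (r : ℂ)) *
          coeff m ((∑ a ∈ U, X a : MvPolynomial (Fin 2 →₀ ℕ) ℂ) ^ r)) *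
        ((∑ i, m.prod fun a k => (coeff a (u i)) ^ k) - ∑ i, m.prod fun a k => (coeff a (v i)) ^ k) := by
  rw [coeff_sum, Finset.sum_mul]
  refine Finset.sum_congr rfl fun r _ => ?_
  rw [coeff_smul, coeff_sub, coeff_sum, coeff_sum, smul_eq_mul]
  simp_rw [DissocLift.coeff_lift_pow]
  rw [← Finset.sum_mul, ← Finset.sum_mul]
  ring

/-- The weight of `φ(m)` is at least `|m|` when every letter of `m` is nonzero. [folklore] -/
theorem degree_le_wt (w : Fin 2 → ℤ) (hw0 : 0 < w 0) (hw1 : 0 < w 1) (U : Finset (Fin 2 →₀ ℕ))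
    (h0 : (0 : Fin 2 →₀ ℕ) ∉ U) (m : (Fin 2 →₀ ℕ) →₀ ℕ) (hm : m.support ⊆ U) :
    (m.degree : ℤ) ≤ w 0 * ((m.sum fun a k => k • a) 0 : ℤ) + w 1 * ((m.sum fun a k => k • a) 1 : ℤ) := by
  -- the weight as an additive monoid hom
  let ω : (Fin 2 →₀ ℕ) →+ ℤ :=
    { toFun := fun p => w 0 * (p 0 : ℤ) + w 1 * (p 1 : ℤ)
      map_zero' := by simp
      map_add' := fun p q => by
        simp only [Finsupp.coe_add, Pi.add_apply]
        push_cast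
        ring }
  have hω : ∀ p : Fin 2 →₀ ℕ, ω p = w 0 * (p 0 : ℤ) + w 1 * (p 1 : ℤ) := fun p => rfl
  rw [← hω, map_finsuppSum, Finsupp.degree_apply]
  push_cast
  refine Finset.sum_le_sum fun a ha => ?_
  show (m a : ℤ) ≤ ω (m a • a)
  rw [map_nsmul, hω, nsmul_eq_mul]
  have h1 : (1 : ℤ) ≤ w 0 * (a 0 : ℤ) + w 1 * (a 1 : ℤ) :=
    PowerSum.one_le_wt_of_ne_zero w hw0 hw1 a (fun ha0 => h0 (ha0 ▸ hm ha))
  have hk : (0 : ℤ) ≤ (m a : ℤ) := Nat.cast_nonneg _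
  nlinarith

/-- **Bridge** (rung piece R3): in the dissociated regime a unique `w`-lightest support point of `∏u − ∏v` comes from a
unique multiset with nonzero moment, all of whose weight-`≤` competitors have vanishing moment. [folklore] -/
theorem stub_dissocBridge : ∀ (n : ℕ) (u v : Fin n → MvPolynomial (Fin 2) ℂ),
    (∀ i, MvPolynomial.coeff 0 (u i) = 1) → (∀ i, MvPolynomial.coeff 0 (v i) = 1) →
    ∀ (w : Fin 2 → ℤ), 0 < w 0 → 0 < w 1 → ∀ (e : Fin 2 →₀ ℕ),
    (e ∈ (∏ i, u i - ∏ i, v i).support ∧ ∀ e' ∈ (∏ i, u i - ∏ i, v i).support, e' ≠ e →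
      w 0 * (e 0 : ℤ) + w 1 * (e 1 : ℤ) < w 0 * (e' 0 : ℤ) + w 1 * (e' 1 : ℤ)) →
    (∀ m m' : (Fin 2 →₀ ℕ) →₀ ℕ,
      m.support ⊆ (Finset.univ.biUnion fun i => (u i).support ∪ (v i).support).erase 0 →
      m'.support ⊆ (Finset.univ.biUnion fun i => (u i).support ∪ (v i).support).erase 0 →
      w 0 * ((m.sum fun a k => k • a) 0 : ℤ) + w 1 * ((m.sum fun a k => k • a) 1 : ℤ) ≤
        w 0 * (e 0 : ℤ) + w 1 * (e 1 : ℤ) →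
      (m.sum fun a k => k • a) = (m'.sum fun a k => k • a) → m = m') →
    ∃ ms : (Fin 2 →₀ ℕ) →₀ ℕ,
      ms.support ⊆ (Finset.univ.biUnion fun i => (u i).support ∪ (v i).support).erase 0 ∧
      (ms.sum fun a k => k • a) = e ∧
      ((∑ i, ms.prod fun a k => (MvPolynomial.coeff a (u i)) ^ k) -
        (∑ i, ms.prod fun a k => (MvPolynomial.coeff a (v i)) ^ k)) ≠ 0 ∧
      ∀ m : (Fin 2 →₀ ℕ) →₀ ℕ,
        m.support ⊆ (Finset.univ.biUnion fun i => (u i).support ∪ (v i).support).erase 0 → m ≠ ms →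
        w 0 * ((m.sum fun a k => k • a) 0 : ℤ) + w 1 * ((m.sum fun a k => k • a) 1 : ℤ) ≤
          w 0 * (e 0 : ℤ) + w 1 * (e 1 : ℤ) →
        ((∑ i, m.prod fun a k => (MvPolynomial.coeff a (u i)) ^ k) -
          (∑ i, m.prod fun a k => (MvPolynomial.coeff a (v i)) ^ k)) = 0 := by
  classical
  intro n u v hu hv w hw0 hw1 e hmin hinj
  -- abbreviations: letters, weight, exponent map, moments, lifted log power sum, the universal constant
  set U : Finset (Fin 2 →₀ ℕ) := (Finset.univ.biUnion fun i => (u i).support ∪ (v i).support).erase 0 with hUdef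
  set wt : (Fin 2 →₀ ℕ) → ℤ := fun p => w 0 * (p 0 : ℤ) + w 1 * (p 1 : ℤ) with hwt
  set phi : ((Fin 2 →₀ ℕ) →₀ ℕ) → (Fin 2 →₀ ℕ) := fun m => m.sum fun a k => k • a with hphi
  set μ : ((Fin 2 →₀ ℕ) →₀ ℕ) → ℂ := fun m =>
    (∑ i, m.prod fun a k => (coeff a (u i)) ^ k) - ∑ i, m.prod fun a k => (coeff a (v i)) ^ k with hμ
  have h0U : (0 : Fin 2 →₀ ℕ) ∉ U := by simp [hUdef]
  have hsuppU : ∀ i, ∀ a ∈ (u i).support, a ≠ 0 → a ∈ U := fun i a ha ha0 => by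
    simp only [hUdef, Finset.mem_erase, Finset.mem_biUnion, Finset.mem_univ, Finset.mem_union, true_and]
    exact ⟨ha0, i, Or.inl ha⟩
  have hsuppV : ∀ i, ∀ a ∈ (v i).support, a ≠ 0 → a ∈ U := fun i a ha ha0 => by
    simp only [hUdef, Finset.mem_erase, Finset.mem_biUnion, Finset.mem_univ, Finset.mem_union, true_and]
    exact ⟨ha0, i, Or.inr ha⟩
  -- the truncation order
  have hwe : 0 ≤ wt e := by
    have := Nat.cast_nonneg (α := ℤ) (e 0); have := Nat.cast_nonneg (α := ℤ) (e 1)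
    simp only [hwt]; nlinarith
  set R : ℕ := (wt e).toNat + 1 with hRdef
  have heR : wt e < (R : ℤ) := by
    simp only [hRdef]; push_cast; rw [Int.toNat_of_nonneg hwe]; linarith
  set L : MvPolynomial (Fin 2 →₀ ℕ) ℂ := ∑ r ∈ Finset.Icc 1 R, ((-1 : ℂ) ^ (r + 1) / (r : ℂ)) •
    (∑ i, (∑ a ∈ U, C (coeff a (u i)) * X a : MvPolynomial (Fin 2 →₀ ℕ) ℂ) ^ r -
      ∑ i, (∑ a ∈ U, C (coeff a (v i)) * X a : MvPolynomial (Fin 2 →₀ ℕ) ℂ) ^ r) with hL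
  set K : ((Fin 2 →₀ ℕ) →₀ ℕ) → ℂ := fun m => ∑ r ∈ Finset.Icc 1 R, ((-1 : ℂ) ^ (r + 1) / (r : ℂ)) *
    coeff m ((∑ a ∈ U, X a : MvPolynomial (Fin 2 →₀ ℕ) ℂ) ^ r) with hK
  have hcoeffL : ∀ m, coeff m L = K m * μ m := fun m => coeff_liftLog u v U R m
  have hsuppL : ∀ m ∈ L.support, m.support ⊆ U ∧ 1 ≤ m.degree ∧ m.degree ≤ R := by
    intro m hm
    rw [mem_support_iff, hcoeffL] at hm
    exact DissocLift.KR_ne_zero_imp U R m (left_ne_zero_of_mul hm)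
  -- power-sum criterion: `e` is the unique lightest support point of `Λ_R = π(L)`
  have hPS := (PowerSum.stub_powerSumCriterion n u v hu hv w hw0 hw1 e R heR).mp hmin
  rw [← proj_liftLog u v hu hv U h0U hsuppU hsuppV R] at hPS
  obtain ⟨heS, hmin'⟩ := hPS
  -- the projection formula
  have hcoeff : ∀ p : Fin 2 →₀ ℕ,
      coeff p (aeval (fun a : Fin 2 →₀ ℕ => (monomial a (1 : ℂ) : MvPolynomial (Fin 2) ℂ)) L) =
        ∑ m ∈ L.support with phi m = p, coeff m L := fun p => DissocLift.coeff_proj L p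
  -- fibres of weight ≤ wt e inside the support of `L` are singletons
  have hfib : ∀ m ∈ L.support, ∀ m' ∈ L.support, wt (phi m) ≤ wt e → phi m = phi m' → m = m' :=
    fun m hm m' hm' hwm hph => hinj m m' (hsuppL m hm).1 (hsuppL m' hm').1 hwm hph
  -- existence of `ms`
  have heS' := mem_support_iff.mp heS
  rw [hcoeff] at heS'
  obtain ⟨ms, hmsF, -⟩ := Finset.exists_ne_zero_of_sum_ne_zero heS'
  rw [Finset.mem_filter] at hmsF
  obtain ⟨hmsS, hmse⟩ := hmsF
  have hmsU : ms.support ⊆ U := (hsuppL ms hmsS).1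
  have hfib_e : (L.support.filter fun m => phi m = e) = {ms} := by
    refine Finset.eq_singleton_iff_unique_mem.mpr ⟨Finset.mem_filter.mpr ⟨hmsS, hmse⟩, ?_⟩
    intro m hm
    rw [Finset.mem_filter] at hm
    exact hfib m hm.1 ms hmsS (by rw [hm.2]) (by rw [hm.2, hmse])
  have hμms : μ ms ≠ 0 := by
    have h := mem_support_iff.mp heS
    rw [hcoeff, hfib_e, Finset.sum_singleton, hcoeffL] at h
    exact right_ne_zero_of_mul h
  refine ⟨ms, hmsU, hmse, hμms, ?_⟩
  -- deadness of the competitors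
  intro m hmU hmne hmw
  change μ m = 0
  by_cases hm0 : m = 0
  · simp [hμ, hm0]
  have hdeg1 : 1 ≤ m.degree := by
    rw [Nat.one_le_iff_ne_zero, Ne, Finsupp.degree_eq_zero_iff]; exact hm0
  have hdegR : m.degree ≤ R := by
    have h1 := degree_le_wt w hw0 hw1 U h0U m hmU
    have : (m.degree : ℤ) < (R : ℤ) := lt_of_le_of_lt (le_trans h1 hmw) heR
    exact_mod_cast this.le
  have hKm : K m ≠ 0 := DissocLift.KR_ne_zero U R m hmU hdeg1 hdegR
  -- `φ(m) ≠ e` has weight `≤ wt e`, hence is not in the support of `Λ_R`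
  have hpe : phi m ≠ e := fun h => hmne (hinj m ms hmU hmsU hmw (show phi m = phi ms by rw [h]; exact hmse.symm))
  have hp : coeff (phi m) (aeval (fun a : Fin 2 →₀ ℕ => (monomial a (1 : ℂ) : MvPolynomial (Fin 2) ℂ)) L) = 0 := by
    by_contra hne
    exact absurd hmw (not_le.mpr (hmin' (phi m) (mem_support_iff.mpr hne) hpe))
  -- hence `coeff_m L = 0` and `μ(m) = 0`
  have hcm : coeff m L = 0 := by
    by_contra hne
    have hmS : m ∈ L.support := mem_support_iff.mpr hne
    have hfib_m : (L.support.filter fun m' => phi m' = phi m) = {m} := by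
      refine Finset.eq_singleton_iff_unique_mem.mpr ⟨Finset.mem_filter.mpr ⟨hmS, rfl⟩, ?_⟩
      intro m' hm'
      rw [Finset.mem_filter] at hm'
      exact hfib m' hm'.1 m hmS (by rw [hm'.2]; exact hmw) hm'.2
    rw [hcoeff, hfib_m, Finset.sum_singleton] at hp
    exact hne hp
  rw [hcoeffL] at hcm
  exact (mul_eq_zero.mp hcm).resolve_left hKm

end Summit.ValiantsHypothesis.ValiantsHypothesis.Theorems.TwoProducts.DissocBridge
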